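import Mathlib
import HarnessLib

/-!
# Polynomial tools for the ray theorems on nested sectors

(Line `janus-bands`, crux `ArrangementNormalForm`, stub `stub_separateHigh`, part `HHKPoly` of
the wall-invariant termwise-split lemma `separateThree_hHk` in base dimension `3` with fibres.)
Elementary facts about real polynomials in one and two variables used to control the Taylor
pieces on a nested thin sector `z₁ + t (d + v (Q + u S))` in the FREE variables (those in which
the weight has only a logarithmic contraction cost):
* `coef_eq_zero_of_forall`: `∑ γ j s^j = 0` on an infinite set forces `γ = 0`;
* `lam_indep`: `∑ᵢ λ(ξ)^i hᵢ(ξ′) ≡ 0` on `ℝ³` (`λ(ξ) = ξ₂ − l₁ ξ₀ − l₂ ξ₁`, `hᵢ` depending on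
  `ξ′ = (ξ₀, ξ₁)` only) forces every `hᵢ ≡ 0` — the pole coordinate is transcendental over the
  functions of the other two coordinates; this is what makes the Taylor split `t`-graded;
* `indep_binary`: the functions `u ↦ L₁(u)^i L₂(u)^{b−i}` (`Lₖ(u) = αₖ + σₖ u`,
  `det(L₁, L₂) ≠ 0`) are linearly independent on every interval — the bigrading exactness of the
  slope-`r` frames at a direction of the pole plane;
* `exists_rootfree`, `exists_pos_lower`: a non-zero polynomial has no roots on some `(0, u₁)`,
  `u₁ ≤ 1`, and a continuous non-vanishing function has a positive lower bound on a compact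
  interval;
* `lower_dyadic₂` (registered as `separateThreeHHK_poly`): a non-zero BIVARIATE polynomial
  `P(v, u)` is bounded below by a positive constant on the dyadic boxes
  `[2ε, 4ε] × [2η, 4η]` for all small `ε` and all `η` small in terms of `ε` (trailing coefficient
  in `u`, its roots in `v`, and a tail estimate).
-/

noncomputable section

open Set Polynomial
open scoped Polynomial.Bivariate

namespace Summit.KontsevichZagierPeriods.ArrangementNormalForm.JanusBands

namespace SepHHK

/-! ### Coefficients from values -/

/-- **Vanishing on an infinite set forces vanishing coefficients.** -/
theorem coef_eq_zero_of_forall {D : ℕ} (γ : Fin (D + 1) → ℝ) {S : Set ℝ} (hS : S.Infinite)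
    (h : ∀ s ∈ S, ∑ j : Fin (D + 1), γ j * s ^ (j : ℕ) = 0) : γ = 0 := by
  set R : ℝ[X] := ∑ j : Fin (D + 1), C (γ j) * X ^ (j : ℕ) with hR
  have hev : ∀ s, R.eval s = ∑ j : Fin (D + 1), γ j * s ^ (j : ℕ) := fun s => by
    simp [hR, eval_finsetSum]
  have hR0 : R = 0 := by
    refine Polynomial.eq_zero_of_infinite_isRoot R (hS.mono ?_)
    intro s hs
    show R.IsRoot s
    rw [IsRoot.def, hev s, h s hs]
  funext j
  have hc : R.coeff (j : ℕ) = γ j := by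
    rw [hR, finsetSum_coeff, Finset.sum_eq_single j]
    · rw [coeff_C_mul_X_pow, if_pos rfl]
    · intro j' _ hj'
      rw [coeff_C_mul_X_pow, if_neg (fun h => hj' (Fin.ext h).symm)]
    · intro h; exact absurd (Finset.mem_univ j) h
  rw [← hc, hR0, coeff_zero]
  rfl

/-- **The pole coordinate is transcendental over the other two.** If
`∑ᵢ hᵢ(ξ₀, ξ₁) · (ξ₂ − (l₁ ξ₀ + l₂ ξ₁))^i = 0` for every `ξ ∈ ℝ³`, then every `hᵢ` vanishes
identically. -/
theorem lam_indep {D : ℕ} (h : Fin (D + 1) → (Fin 2 → ℝ) → ℝ) (l₁ l₂ : ℝ)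
    (H : ∀ ξ : Fin 3 → ℝ,
      ∑ i : Fin (D + 1), h i ![ξ 0, ξ 1] * (ξ 2 - (l₁ * ξ 0 + l₂ * ξ 1)) ^ (i : ℕ) = 0)
    (i : Fin (D + 1)) (w : Fin 2 → ℝ) : h i w = 0 := by
  have hw : (![w 0, w 1] : Fin 2 → ℝ) = w := by
    funext k; fin_cases k <;> rfl
  have key : (fun i => h i w) = 0 := by
    refine coef_eq_zero_of_forall (fun i => h i w) Set.infinite_univ (fun s _ => ?_)
    have h1 := H ![w 0, w 1, s + (l₁ * w 0 + l₂ * w 1)]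
    simp only [Matrix.cons_val_zero, Matrix.cons_val_one, Matrix.cons_val_two, Matrix.head_cons,
      Matrix.tail_cons, add_sub_cancel_right] at h1
    rw [hw] at h1
    exact h1
  exact congr_fun key i

/-! ### Independence of products of two affine forms -/

/-- **Linear independence of `L₁^i L₂^{b−i}` on an interval.** For two affine functions
`L₁(u) = α₁ + σ₁ u`, `L₂(u) = α₂ + σ₂ u` with `α₁ σ₂ − α₂ σ₁ ≠ 0`, if
`∑ᵢ γᵢ L₁(u)^i L₂(u)^{b−i} = 0` for all `u` in an interval `(0, η)`, then `γ = 0`. -/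
theorem indep_binary {b : ℕ} (γ : Fin (b + 1) → ℝ) (α₁ σ₁ α₂ σ₂ : ℝ)
    (hdet : α₁ * σ₂ - α₂ * σ₁ ≠ 0) {η : ℝ} (hη : 0 < η)
    (h : ∀ u ∈ Ioo 0 η,
      ∑ i : Fin (b + 1), γ i * (α₁ + σ₁ * u) ^ (i : ℕ) * (α₂ + σ₂ * u) ^ (b - i) = 0) :
    γ = 0 := by
  -- the zero set of `L₂` has at most one point
  set Z : Set ℝ := {u | α₂ + σ₂ * u = 0} with hZ
  have hZs : Z.Subsingleton := by
    intro u hu u' hu'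
    simp only [hZ, mem_setOf_eq] at hu hu'
    have hσ : σ₂ ≠ 0 := by
      intro hs
      rw [hs, zero_mul, add_zero] at hu
      apply hdet
      rw [hs, hu]; ring
    have : σ₂ * (u - u') = 0 := by linarith
    rcases mul_eq_zero.1 this with hs | hs
    · exact absurd hs hσ
    · linarith
  set I : Set ℝ := Ioo 0 η \ Z with hI
  have hIinf : I.Infinite := (Ioo_infinite hη).sdiff hZs.finite
  -- the ratio `L₁/L₂` is injective off the zero set
  set ρ : ℝ → ℝ := fun u => (α₁ + σ₁ * u) / (α₂ + σ₂ * u) with hρ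
  have hρinj : InjOn ρ I := by
    intro u hu u' hu' he
    have hy : α₂ + σ₂ * u ≠ 0 := hu.2
    have hy' : α₂ + σ₂ * u' ≠ 0 := hu'.2
    simp only [hρ] at he
    rw [div_eq_div_iff hy hy'] at he
    have : (α₁ * σ₂ - α₂ * σ₁) * (u' - u) = 0 := by linear_combination he
    rcases mul_eq_zero.1 this with h1 | h1
    · exact absurd h1 hdet
    · linarith
  -- the one-variable polynomial `∑ γᵢ s^i` vanishes on `ρ '' I`
  have hvan : ∀ s ∈ ρ '' I, ∑ i : Fin (b + 1), γ i * s ^ (i : ℕ) = 0 := by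
    rintro _ ⟨u, hu, rfl⟩
    have hy : α₂ + σ₂ * u ≠ 0 := hu.2
    have h0 := h u hu.1
    have key : ∑ i : Fin (b + 1), γ i * ρ u ^ (i : ℕ) =
        (∑ i : Fin (b + 1), γ i * (α₁ + σ₁ * u) ^ (i : ℕ) * (α₂ + σ₂ * u) ^ (b - i)) /
          (α₂ + σ₂ * u) ^ b := by
      rw [Finset.sum_div]
      refine Finset.sum_congr rfl fun i _ => ?_
      have hi : (i : ℕ) ≤ b := Nat.lt_succ_iff.1 i.2
      have hsplit : (α₂ + σ₂ * u) ^ b = (α₂ + σ₂ * u) ^ (b - i) * (α₂ + σ₂ * u) ^ (i : ℕ) := by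
        rw [← pow_add, Nat.sub_add_cancel hi]
      simp only [hρ]
      rw [div_pow, eq_div_iff (pow_ne_zero _ hy), hsplit]
      calc γ i * ((α₁ + σ₁ * u) ^ (i : ℕ) / (α₂ + σ₂ * u) ^ (i : ℕ)) *
            ((α₂ + σ₂ * u) ^ (b - i) * (α₂ + σ₂ * u) ^ (i : ℕ))
          = γ i * ((α₁ + σ₁ * u) ^ (i : ℕ) / (α₂ + σ₂ * u) ^ (i : ℕ) * (α₂ + σ₂ * u) ^ (i : ℕ)) *
              (α₂ + σ₂ * u) ^ (b - i) := by ring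
        _ = γ i * (α₁ + σ₁ * u) ^ (i : ℕ) * (α₂ + σ₂ * u) ^ (b - i) := by
            rw [div_mul_cancel₀ _ (pow_ne_zero _ hy)]
    rw [key, h0, zero_div]
  exact coef_eq_zero_of_forall γ (hIinf.image hρinj) hvan

/-! ### Roots and lower bounds in one variable -/

/-- **No roots near `0⁺`.** A non-zero real polynomial has no roots on some interval `(0, u₁)`
with `0 < u₁ ≤ 1`. -/
theorem exists_rootfree (P : ℝ[X]) (hP : P ≠ 0) :
    ∃ u₁ : ℝ, 0 < u₁ ∧ u₁ ≤ 1 ∧ ∀ u ∈ Ioo 0 u₁, P.eval u ≠ 0 := by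
  classical
  set S := P.roots.toFinset.filter (fun r => 0 < r) with hS
  have hmemS : ∀ u, 0 < u → P.eval u = 0 → u ∈ S := fun u hu h0 =>
    Finset.mem_filter.2 ⟨Multiset.mem_toFinset.2 ((Polynomial.mem_roots hP).2 h0), hu⟩
  by_cases hne : S.Nonempty
  · have hpos : 0 < S.min' hne := (Finset.mem_filter.1 (S.min'_mem hne)).2
    refine ⟨min (S.min' hne) 1, lt_min hpos one_pos, min_le_right _ _, fun u hu h0 => ?_⟩
    have h1 := S.min'_le u (hmemS u hu.1 h0)
    linarith [hu.2, min_le_left (S.min' hne) 1]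
  · exact ⟨1, one_pos, le_rfl, fun u hu h0 => hne ⟨u, hmemS u hu.1 h0⟩⟩

/-- **Positive lower bound of a continuous non-vanishing function on a compact interval.** -/
theorem exists_pos_lower {f : ℝ → ℝ} {a b : ℝ} (hab : a ≤ b) (hf : ContinuousOn f (Icc a b))
    (hne : ∀ x ∈ Icc a b, f x ≠ 0) : ∃ h : ℝ, 0 < h ∧ ∀ x ∈ Icc a b, h ≤ |f x| := by
  obtain ⟨x₀, hx₀, hmin⟩ := isCompact_Icc.exists_isMinOn (nonempty_Icc.2 hab)
    (continuous_abs.comp_continuousOn hf)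
  exact ⟨|f x₀|, abs_pos.2 (hne x₀ hx₀), fun x hx => (isMinOn_iff.1 hmin) x hx⟩

/-! ### The bivariate lower bound on dyadic boxes -/

/-- Evaluation of a bivariate polynomial as a finite sum over the coefficients in the outer
variable. -/
theorem evalEval_eq_sum (PP : ℝ[X][Y]) (v u : ℝ) :
    PP.evalEval v u = ∑ k ∈ Finset.range (PP.natDegree + 1), (PP.coeff k).eval v * u ^ k := by
  have h1 : eval (C u) PP = ∑ k ∈ Finset.range (PP.natDegree + 1), PP.coeff k * (C u) ^ k :=
    eval_eq_sum_range (C u)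
  rw [evalEval, h1, eval_finsetSum]
  refine Finset.sum_congr rfl fun k _ => ?_
  rw [eval_mul, eval_pow, eval_C]

/-- **Lower bound of a non-zero bivariate polynomial on dyadic boxes near the corner.** See the
module docstring. -/
theorem lower_dyadic₂ (PP : ℝ[X][Y]) (hPP : PP ≠ 0) :
    ∃ v₁ : ℝ, 0 < v₁ ∧ v₁ ≤ 1 ∧ ∀ ε : ℝ, 0 < ε → 4 * ε < v₁ →
      ∃ η₀ : ℝ, 0 < η₀ ∧ η₀ ≤ 1 ∧ ∀ η : ℝ, 0 < η → 4 * η ≤ η₀ →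
        ∃ h : ℝ, 0 < h ∧ ∀ v ∈ Icc (2 * ε) (4 * ε), ∀ u ∈ Icc (2 * η) (4 * η),
          h ≤ |PP.evalEval v u| := by
  classical
  set c₀ := PP.natTrailingDegree with hc₀
  set N := PP.natDegree + 1 with hN
  set a : ℕ → ℝ → ℝ := fun k v => (PP.coeff k).eval v with ha
  have hP₀ : PP.coeff c₀ ≠ 0 := by
    rw [hc₀]
    exact trailingCoeff_nonzero_iff_nonzero.2 hPP
  have hc₀N : c₀ ∈ Finset.range N := by
    rw [Finset.mem_range, hN, hc₀]
    exact Nat.lt_succ_of_le (natTrailingDegree_le_natDegree PP)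
  have hlow : ∀ k < c₀, ∀ v, a k v = 0 := fun k hk v => by
    simp only [ha, coeff_eq_zero_of_lt_natTrailingDegree hk, eval_zero]
  -- the tail bound
  set T : ℝ → ℝ := fun v => ∑ k ∈ Finset.range N, |a k v| with hT
  have hTc : Continuous T := by
    refine continuous_finsetSum _ fun k _ => ?_
    exact (Polynomial.continuous (PP.coeff k)).abs
  obtain ⟨R₀, hR₀⟩ := isCompact_Icc.exists_bound_of_continuousOn (hTc.continuousOn (s := Icc (0 : ℝ) 1))
  set R : ℝ := max R₀ 1 with hR
  have hR0 : 0 < R := lt_of_lt_of_le one_pos (le_max_right _ _)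
  have hTR : ∀ v ∈ Icc (0 : ℝ) 1, T v ≤ R := fun v hv => by
    have h1 := hR₀ v hv
    rw [Real.norm_eq_abs, abs_of_nonneg (Finset.sum_nonneg fun k _ => abs_nonneg _)] at h1
    exact h1.trans (le_max_left _ _)
  -- the key estimate `|P(v,u)| ≥ u^{c₀} (|a_{c₀}(v)| − u R)` for `u, v ∈ [0, 1]`
  have hkey : ∀ v ∈ Icc (0 : ℝ) 1, ∀ u ∈ Icc (0 : ℝ) 1,
      u ^ c₀ * (|a c₀ v| - u * R) ≤ |PP.evalEval v u| := by
    intro v hv u hu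
    rw [evalEval_eq_sum, ← Finset.add_sum_erase _ _ hc₀N]
    have htail : |∑ k ∈ (Finset.range N).erase c₀, a k v * u ^ k| ≤ u ^ (c₀ + 1) * R := by
      calc |∑ k ∈ (Finset.range N).erase c₀, a k v * u ^ k|
          ≤ ∑ k ∈ (Finset.range N).erase c₀, |a k v * u ^ k| := Finset.abs_sum_le_sum_abs _ _
        _ ≤ ∑ k ∈ (Finset.range N).erase c₀, |a k v| * u ^ (c₀ + 1) := by
            refine Finset.sum_le_sum fun k hk => ?_
            rw [abs_mul, abs_of_nonneg (pow_nonneg hu.1 _)]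
            have hkc : k ≠ c₀ := (Finset.mem_erase.1 hk).1
            rcases lt_or_gt_of_ne hkc with hlt | hgt
            · rw [hlow k hlt v, abs_zero, zero_mul, zero_mul]
            · exact mul_le_mul_of_nonneg_left (pow_le_pow_of_le_one hu.1 hu.2 hgt) (abs_nonneg _)
        _ = (∑ k ∈ (Finset.range N).erase c₀, |a k v|) * u ^ (c₀ + 1) := by rw [Finset.sum_mul]
        _ ≤ T v * u ^ (c₀ + 1) := by
            refine mul_le_mul_of_nonneg_right ?_ (pow_nonneg hu.1 _)
            exact Finset.sum_le_sum_of_subset_of_nonneg (Finset.erase_subset _ _)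
              fun k _ _ => abs_nonneg _
        _ ≤ R * u ^ (c₀ + 1) := mul_le_mul_of_nonneg_right (hTR v hv) (pow_nonneg hu.1 _)
        _ = u ^ (c₀ + 1) * R := by ring
    have hmain : |a c₀ v| * u ^ c₀ - u ^ (c₀ + 1) * R ≤
        |a c₀ v * u ^ c₀ + ∑ k ∈ (Finset.range N).erase c₀, a k v * u ^ k| := by
      have h1 := abs_sub_abs_le_abs_sub (a c₀ v * u ^ c₀)
        (-(∑ k ∈ (Finset.range N).erase c₀, a k v * u ^ k))
      rw [abs_neg, sub_neg_eq_add, abs_mul, abs_of_nonneg (pow_nonneg hu.1 _)] at h1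
      linarith
    calc u ^ c₀ * (|a c₀ v| - u * R) = |a c₀ v| * u ^ c₀ - u ^ (c₀ + 1) * R := by ring
      _ ≤ _ := hmain
  -- the roots of the trailing coefficient
  obtain ⟨v₁, hv₁, hv₁1, hroot⟩ := exists_rootfree (PP.coeff c₀) hP₀
  refine ⟨v₁, hv₁, hv₁1, fun ε hε hεv => ?_⟩
  obtain ⟨hε', hε'0, hlowε⟩ := exists_pos_lower (f := a c₀) (a := 2 * ε) (b := 4 * ε) (by linarith)
    ((Polynomial.continuous (PP.coeff c₀)).continuousOn) (fun x hx => hroot x ⟨by linarith [hx.1],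
      lt_of_le_of_lt hx.2 hεv⟩)
  refine ⟨min 1 (hε' / (2 * R)), by positivity, min_le_left _ _, fun η hη hη₀ => ?_⟩
  refine ⟨(2 * η) ^ c₀ * (hε' / 2), by positivity, fun v hv u hu => ?_⟩
  have hv01 : v ∈ Icc (0 : ℝ) 1 := ⟨by linarith [hv.1], by linarith [hv.2]⟩
  have hu1 : u ≤ 1 := by linarith [hu.2, min_le_left 1 (hε' / (2 * R))]
  have hu0 : 0 ≤ u := by linarith [hu.1]
  have huR : u * R ≤ hε' / 2 := by
    have h1 : u ≤ hε' / (2 * R) := by linarith [hu.2, min_le_right 1 (hε' / (2 * R))]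
    calc u * R ≤ hε' / (2 * R) * R := mul_le_mul_of_nonneg_right h1 hR0.le
      _ = hε' / 2 := by field_simp
  have h1 := hkey v hv01 u ⟨hu0, hu1⟩
  have h2 : hε' ≤ |a c₀ v| := hlowε v hv
  calc (2 * η) ^ c₀ * (hε' / 2) ≤ u ^ c₀ * (|a c₀ v| - u * R) := by
        refine mul_le_mul (pow_le_pow_left₀ (by linarith) hu.1 _) (by linarith) (by linarith)
          (pow_nonneg hu0 _)
    _ ≤ |PP.evalEval v u| := h1

end SepHHK

/-- **Lower bound of a non-zero bivariate real polynomial on dyadic boxes near the corner**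
(registered part of `stub_separateHigh`, base dimension `3` with fibres; literal form of
`SepHHK.lower_dyadic₂`): for a non-zero `P ∈ ℝ[X][Y]` there is `v₁ ∈ (0, 1]` such that for every
`ε` with `0 < 4ε < v₁` there is `η₀ ∈ (0, 1]` such that for every `η` with `0 < 4η ≤ η₀` the
values `|P(v, u)|` on `[2ε, 4ε] × [2η, 4η]` are bounded below by a positive constant. -/
theorem separateThreeHHK_poly (PP : Polynomial (Polynomial ℝ)) (hPP : PP ≠ 0) : ∃ v₁ : ℝ, 0 < v₁ ∧ v₁ ≤ 1 ∧ ∀ ε : ℝ, 0 < ε → 4 * ε < v₁ → ∃ η₀ : ℝ, 0 < η₀ ∧ η₀ ≤ 1 ∧ ∀ η : ℝ, 0 < η → 4 * η ≤ η₀ → ∃ h : ℝ, 0 < h ∧ ∀ v ∈ Set.Icc (2 * ε) (4 * ε), ∀ u ∈ Set.Icc (2 * η) (4 * η), h ≤ |Polynomial.eval v (Polynomial.eval (Polynomial.C u) PP)| := by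
  exact SepHHK.lower_dyadic₂ PP hPP

end Summit.KontsevichZagierPeriods.ArrangementNormalForm.JanusBands
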